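import Summits.SmoothPoincare4.SmoothPoincare4.Theorems.ConvexBisectionAcyclicBisectionExistsHurwitzMoveClasses
import Summits.SmoothPoincare4.SmoothPoincare4.Theorems.ConvexBisectionAcyclicBisectionExistsBeltMonodromyPages
import HarnessLib

/-!
# N1 ▸ `node_N1_move` ▸ (c₁) THE FREE SLICE MOVE, sub-piece (seam): push-off and rigid transport
# through `Ψ`, read back on the base
(wave 8, brick of stub `stub_M2geo` = node N1 of NF4 ▸ `node_N1_move_of_pieces (HC1) …` ▸ `HC1` ▸ the
hypothesis `HSEAM` of the contract `piece_c1_of_subpieces (HCORE) (HSEAM) (HISO) : HC1`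
(`…SliceMoveContract.lean`); line `modp-braid-orbits`, crux `ConvexBisection.AcyclicBisectionExists`, item
stmt-SmoothPoincare4-10508; worker J5, lead c5; design v3 `work/design/N1_SliceMove_Design.lean`;
registered sub-goal `helper_mem_coresComplement_of_mem_page`)

Data: the fibred datum `(X₀, bX, Ψ, X, G₀, h, D)` of `node_N1_move` with unit directions `d` (cores in the
pages `page g (d k)`), the SEAM clause (`G₀ (bX.incl y) = D.jA a ⇒ w (Ψ y) ∈ ℝ_{>0} w a`) and the BELT
clause (`G₀ (bX.incl y) = D.jB k b ∉ range D.jA ⇒ w (Ψ y) ∈ ℝ_{>0} d k`) through `G₀`; the handle `k₀`, a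
signed angle `ψ` (`0 < |ψ| < 2π`), the rigid page rotation `R` (`rho ∘ R_t = rho`, `w ∘ R_t = e^{it} w`,
flat part kept) and FREENESS (no other direction `d k` on the closed arc `d k₀ e^{itψ}`, `t ∈ [0, 1]`).
Output (`piece_c1_seam`, clauses 1–9 of `HC1` with `R₁ := R`, `τ₁ := ε`): the push-off angle
`ε := ψ / 2`; the push-off `L := R ε ∘ K` of the old attaching circle `K` of `k₀`, a loop of the seam page
of direction `d k₀ e^{iε}` (§1: a page point off all core directions lies off all cores,
`helper_mem_coresComplement_of_mem_page`), with its seam presentation `a θ := L θ`,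
`G₀ (bX.incl (y θ)) = D.jA (a θ)` (`exists_carrier_of_jA`, H4); the RIGID TRANSPORT THROUGH `Ψ`:
`y' θ := Ψ⁻¹ (incl⁻¹ (R_{ψ−ε} (incl (Ψ (y θ)))))` (`R` keeps `rho`, hence the boundary); the transported
points are seam points (`mem_range_jA_of_rotate`, H7: the belt clause would put a direction `d k` at the
free angle `ψ`), read back as `a' θ`, `L' θ := a' θ`; continuity of `L`, `L'` (inverses of embeddings are
continuous on their ranges, `continuousOn_invFun_range`).  Everything is proved; no definitions, no named
facts, no `sorry`.  Reference: R. E. Gompf, A. I. Stipsicz, *4-Manifolds and Kirby Calculus* (1999), §8.2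
[GompfStipsicz1999].
-/

noncomputable section

set_option linter.dupNamespace false

open scoped Manifold ContDiff Topology Real
open Set Function

namespace Summit.SmoothPoincare4.SmoothPoincare4.Theorems.AcyclicBisectionExists.ModpBraidOrbits

open Literature.GroupTheory.CombinatorialGroupTheory.SignedHurwitz
open Literature.Topology.FourManifolds Literature.Topology.FourManifolds.LefschetzBase
open Literature.Topology.FourManifolds.HandleAttachingMap
open HurwitzMoveClasses

/-! ## §1 Page points off the core directions lie off the cores -/

/-- **Sub-goal `helper_mem_coresComplement_of_mem_page`** (fully qualified): if every attaching circle
`K_k` lies in the page of direction `d k`, then a point of the page of a direction `c` different from all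
the `d k` lies off all the cores (pages of distinct directions are disjoint, `disjoint_page`; the core is
the range of the attaching circle, `range_attachingCircle`). [folklore] -/
theorem helper_mem_coresComplement_of_mem_page : ∀ (g n : ℕ) (h : Fin n → Literature.Topology.FourManifolds.HandleAttachingMap 3 2 (Literature.Topology.FourManifolds.LefschetzBase.Base g)) (d : Fin n → ℂ), (∀ k θ, (h k).attachingCircle θ ∈ Literature.Topology.FourManifolds.LefschetzBase.page g (d k)) → ∀ (c : ℂ) (x : Literature.Topology.FourManifolds.LefschetzBase.Base g), x ∈ Literature.Topology.FourManifolds.LefschetzBase.page g c → (∀ k, d k ≠ c) → x ∈ Literature.Topology.FourManifolds.HandleAttachingMap.coresComplement h := by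
  intro g n h d hpg c x hx hc
  rw [mem_coresComplement]
  intro k hk
  rw [← range_attachingCircle] at hk
  obtain ⟨θ, hθ⟩ := hk
  exact Set.disjoint_left.1 (disjoint_page g (hc k)) (hpg k θ) (hθ ▸ hx)

/-! ## §2 The seam bookkeeping of the free slice move -/

set_option maxHeartbeats 800000 in
-- a ∀-text of 40 binders; the witnesses are read through three inverse embeddings
/-- **Sub-piece (seam) of `HC1`** (= hypothesis `HSEAM` of `piece_c1_of_subpieces`): the push-off
`L = R ε ∘ K` (`ε = ψ/2`) into the seam page of direction `d k₀ e^{iε}`, its seam presentation `(y, a)`,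
the rigid transport through `Ψ` by `ψ − ε` and its reading `(y', a', L')` on the base — clauses 1–9 of
`HC1` with `R₁ := R`, `τ₁ := ε`, and the continuity of `L`, `L'`. [cite: GompfStipsicz1999, §8.2] -/
theorem piece_c1_seam : ∀ (g n : ℕ) (X₀ : Type) [TopologicalSpace X₀] [T2Space X₀] [SecondCountableTopology X₀] [CompactSpace X₀] [ChartedSpace (EuclideanHalfSpace 4) X₀] [IsManifold (𝓡∂ 4) ∞ X₀] (bX : BoundaryData (𝓡∂ 4) X₀ (𝓡 3)) (Ψ : bX.carrier ≃ₘ⟮𝓡 3, 𝓡 3⟯ (bBase g).carrier) (X : Type) [TopologicalSpace X] [T2Space X] [SecondCountableTopology X] [CompactSpace X] [ChartedSpace (EuclideanHalfSpace 4) X] [IsManifold (𝓡∂ 4) ∞ X] (G₀ : X₀ ≃ₘ⟮𝓡∂ 4, 𝓡∂ 4⟯ X) (h : Fin n → HandleAttachingMap 3 2 (Base g)) (D : MultiAttachmentData h (𝓡∂ 4) X) (d : Fin n → ℂ), (∀ k, ‖d k‖ = 1) → (∀ k θ, (h k).attachingCircle θ ∈ page g (d k)) → (∀ (y : bX.carrier)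 (a : ↥(coresComplement h)), G₀ (bX.incl y) = D.jA a → ∃ c : ℝ, 0 < c ∧ w g ((bBase g).incl (Ψ y)).1 = (c : ℂ) * w g (a : Base g).1) → (∀ (y : bX.carrier) (k : Fin n) (b : ↥(beltPiece 3 2)), G₀ (bX.incl y) = D.jB k b → G₀ (bX.incl y) ∉ range D.jA → ∃ c : ℝ, 0 < c ∧ w g ((bBase g).incl (Ψ y)).1 = (c : ℂ) * d k) → ∀ (k₀ : Fin n) (ψ : ℝ) (R : AmbientIsotopy (𝓡∂ 4) (Base g)), ψ ≠ 0 → |ψ| < 2 * π → (∀ (t : ℝ) (x : Base g), rho g (R.toFun t x).1 = rho g x.1) → (∀ (t : ℝ) (x : Base g), w g (R.toFun t x).1 = Complex.exp ((t : ℂ) * Complex.I) * w g x.1) → (∀ (t : ℝ) (x : Base g), ‖cx (R.toFun t x).1‖ ^ 2 < 4 ↔ ‖cx x.1‖ ^ 2 < 4) → (∀ (t t' : ℝ) (x : Base g), R.toFun t (R.toFun t' x) = R.toFun (t + t') x) → (∀ k, k ≠ k₀ → ∀ t ∈ Set.Icc (0 : ℝ) 1, d k ≠ d k₀ * Complex.exp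 (((t * ψ : ℝ) : ℂ) * Complex.I)) → ∃ (ε : ℝ) (L L' : Metric.sphere (0 : EuclideanSpace ℝ (Fin 2)) 1 → Base g) (y y' : Metric.sphere (0 : EuclideanSpace ℝ (Fin 2)) 1 → bX.carrier) (a a' : Metric.sphere (0 : EuclideanSpace ℝ (Fin 2)) 1 → ↥(coresComplement h)), (0 < ε / ψ ∧ ε / ψ < 1) ∧ Continuous L ∧ Continuous L' ∧ (∀ θ, L θ = R.toFun ε ((h k₀).attachingCircle θ)) ∧ (∀ θ, L θ ∈ page g (d k₀ * Complex.exp ((ε : ℂ) * Complex.I))) ∧ (∀ θ, G₀ (bX.incl (y θ)) = D.jA (a θ)) ∧ (∀ θ, ((a θ : ↥(coresComplement h)) : Base g) = L θ) ∧ (∀ θ, (bBase g).incl (Ψ (y' θ)) = R.toFun (ψ - ε) ((bBase g).incl (Ψ (y θ)))) ∧ (∀ θ, G₀ (bX.incl (y' θ)) = D.jA (a' θ)) ∧ (∀ θ, ((a' θ : ↥(coresComplement h)) : Base g) = L' θ) := by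
  intro g n X₀ _ _ _ _ _ _ bX Ψ X _ _ _ _ _ _ G₀ h D d hd hpg hseam hbelt k₀ ψ R hψ0 hψ hRρ hRw hRcx _ hfree
  classical
  -- §a angles: the push-off angle is `ψ / 2`
  have hψ2 : (ψ / 2) / ψ = 1 / 2 := by field_simp
  have hεψ : 0 < ψ / 2 / ψ ∧ ψ / 2 / ψ < 1 := by rw [hψ2]; norm_num
  have hε0 : ψ / 2 ≠ 0 := div_ne_zero hψ0 two_ne_zero
  have hεlt : |ψ / 2| < 2 * π := by
    rw [abs_div, abs_two]; linarith [abs_nonneg ψ]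
  have hd0 : d k₀ ≠ 0 := norm_ne_zero_iff.1 (by rw [hd k₀]; norm_num)
  have hu : ∀ t : ℝ, ‖d k₀ * Complex.exp ((t : ℂ) * Complex.I)‖ = 1 := fun t => by
    rw [norm_mul, hd, Complex.norm_exp_ofReal_mul_I, mul_one]
  -- no core direction at the push-off angle `ψ/2` …
  have hfreeε : ∀ k, d k ≠ d k₀ * Complex.exp (((ψ / 2 : ℝ) : ℂ) * Complex.I) := by
    intro k
    by_cases hk : k = k₀
    · subst hk
      intro he
      refine exp_ofReal_mul_I_ne_one hε0 hεlt ?_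
      nth_rw 1 [← mul_one (d k)] at he
      exact (mul_left_cancel₀ hd0 he).symm
    · have h1 := hfree k hk (1 / 2) ⟨by norm_num, by norm_num⟩
      have e : ((1 / 2 * ψ : ℝ) : ℂ) = ((ψ / 2 : ℝ) : ℂ) := by push_cast; ring
      rwa [e] at h1
  -- … nor at the target angle `ψ = ψ/2 + (ψ − ψ/2)`
  have hfreeψ : ∀ k, d k ≠ d k₀ * Complex.exp (((ψ / 2 : ℝ) : ℂ) * Complex.I) *
      Complex.exp (((ψ - ψ / 2 : ℝ) : ℂ) * Complex.I) := by
    intro k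
    have e : d k₀ * Complex.exp (((ψ / 2 : ℝ) : ℂ) * Complex.I) *
        Complex.exp (((ψ - ψ / 2 : ℝ) : ℂ) * Complex.I) = d k₀ * Complex.exp ((ψ : ℂ) * Complex.I) := by
      rw [mul_assoc, ← Complex.exp_add]
      congr 2
      push_cast
      ring
    rw [e]
    by_cases hk : k = k₀
    · subst hk
      intro he
      refine exp_ofReal_mul_I_ne_one hψ0 hψ ?_
      nth_rw 1 [← mul_one (d k)] at he
      exact (mul_left_cancel₀ hd0 he).symm
    · have h1 := hfree k hk 1 ⟨by norm_num, by norm_num⟩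
      have e1 : ((1 * ψ : ℝ) : ℂ) = (ψ : ℂ) := by push_cast; ring
      rwa [e1] at h1
  -- §b the push-off `L = R (ψ/2) ∘ K`, a loop of the seam page of direction `d k₀ e^{iψ/2}`
  set L : Metric.sphere (0 : EuclideanSpace ℝ (Fin 2)) 1 → Base g :=
    fun θ => R.toFun (ψ / 2) ((h k₀).attachingCircle θ)
  have hLp : ∀ θ, L θ ∈ page g (d k₀ * Complex.exp (((ψ / 2 : ℝ) : ℂ) * Complex.I)) := by
    intro θ
    refine ⟨(hRcx _ _).2 (hpg k₀ θ).1, ?_⟩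
    show w g (R.toFun (ψ / 2) ((h k₀).attachingCircle θ)).1 = _
    rw [hRw, (hpg k₀ θ).2]
    ring
  have hLc : Continuous L :=
    (R.contMDiff_toFun (ψ / 2)).continuous.comp (h k₀).continuous_attachingCircle
  have hLoff : ∀ θ, L θ ∈ coresComplement h := fun θ =>
    helper_mem_coresComplement_of_mem_page g n h d hpg _ (L θ) (hLp θ) hfreeε
  set a : Metric.sphere (0 : EuclideanSpace ℝ (Fin 2)) 1 → ↥(coresComplement h) :=
    fun θ => ⟨L θ, hLoff θ⟩
  have hac : Continuous a := hLc.subtype_mk hLoff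
  have hLbd : ∀ θ, ((a θ : ↥(coresComplement h)) : Base g) ∈ (𝓡∂ 4).boundary (Base g) := fun θ =>
    page_subset_boundary g (hu (ψ / 2)) (hLp θ)
  -- §c the seam presentation `y` of `L` (`exists_carrier_of_jA`, read through `(G₀ ∘ incl)⁻¹`)
  have θ₀ : Metric.sphere (0 : EuclideanSpace ℝ (Fin 2)) 1 := circlePt 0
  obtain ⟨y₀, -⟩ := exists_carrier_of_jA bX G₀ D (hLbd θ₀)
  haveI : Nonempty bX.carrier := ⟨y₀⟩
  haveI : Nonempty ↥(coresComplement h) := ⟨a θ₀⟩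
  haveI : Nonempty (bBase g).carrier := ⟨Ψ y₀⟩
  have hincl : Topology.IsEmbedding (bBase g).incl := (bBase g).isSmoothEmbedding.isEmbedding
  have hGi : Topology.IsEmbedding (fun x : bX.carrier => G₀ (bX.incl x)) :=
    G₀.toHomeomorph.isEmbedding.comp bX.isSmoothEmbedding.isEmbedding
  have hjA : Topology.IsEmbedding D.jA := D.hjA.isEmbedding
  set iB : Base g → (bBase g).carrier := Function.invFun (bBase g).incl
  set iA : X → ↥(coresComplement h) := Function.invFun D.jA
  set iG : X → bX.carrier := Function.invFun (fun x : bX.carrier => G₀ (bX.incl x))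
  have hiBc : ContinuousOn iB (range (bBase g).incl) := continuousOn_invFun_range hincl
  have hiAc : ContinuousOn iA (range D.jA) := continuousOn_invFun_range hjA
  have hiGc : ContinuousOn iG (range fun x : bX.carrier => G₀ (bX.incl x)) :=
    continuousOn_invFun_range hGi
  set y : Metric.sphere (0 : EuclideanSpace ℝ (Fin 2)) 1 → bX.carrier := fun θ => iG (D.jA (a θ))
  have hy : ∀ θ, G₀ (bX.incl (y θ)) = D.jA (a θ) := fun θ =>
    Function.invFun_eq (f := fun x : bX.carrier => G₀ (bX.incl x))
      (exists_carrier_of_jA bX G₀ D (hLbd θ))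
  have hyc : Continuous y :=
    hiGc.comp_continuous (hjA.continuous.comp hac) fun θ => ⟨y θ, hy θ⟩
  -- §d the rigid transport through `Ψ` by `ψ − ψ/2` (`R` keeps `rho`, hence the boundary)
  set zB : Metric.sphere (0 : EuclideanSpace ℝ (Fin 2)) 1 → Base g :=
    fun θ => R.toFun (ψ - ψ / 2) ((bBase g).incl (Ψ (y θ)))
  have hzBmem : ∀ θ, zB θ ∈ range (bBase g).incl := by
    intro θ
    rw [(bBase g).range_incl, RegularSublevel.mem_boundary_iff]
    show rho g (R.toFun (ψ - ψ / 2) ((bBase g).incl (Ψ (y θ)))).1 = 1 / 4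
    rw [hRρ]
    exact (RegularSublevel.mem_boundary_iff (isRegularLevel_rho g) _).1
      ((bBase g).incl_mem_boundary _)
  have hzBincl : ∀ θ, (bBase g).incl (iB (zB θ)) = zB θ := fun θ => Function.invFun_eq (hzBmem θ)
  have hzBc : Continuous zB :=
    (R.contMDiff_toFun (ψ - ψ / 2)).continuous.comp
      ((bBase g).continuous_incl.comp (Ψ.continuous.comp hyc))
  set y' : Metric.sphere (0 : EuclideanSpace ℝ (Fin 2)) 1 → bX.carrier := fun θ => Ψ.symm (iB (zB θ))
  have hrel : ∀ θ, (bBase g).incl (Ψ (y' θ)) = R.toFun (ψ - ψ / 2) ((bBase g).incl (Ψ (y θ))) := by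
    intro θ
    show (bBase g).incl (Ψ (Ψ.symm (iB (zB θ)))) = zB θ
    rw [Diffeomorph.apply_symm_apply, hzBincl]
  have hy'c : Continuous y' := Ψ.symm.continuous.comp (hiBc.comp_continuous hzBc hzBmem)
  -- §e reading back: the transported points are seam points (`mem_range_jA_of_rotate`)
  have hmem : ∀ θ, G₀ (bX.incl (y' θ)) ∈ range D.jA := fun θ =>
    mem_range_jA_of_rotate bX Ψ G₀ D hd hseam hbelt R hRw (hu (ψ / 2)) (τ := ψ - ψ / 2) hfreeψ (hy θ)
      (hLp θ) (hrel θ)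
  set a' : Metric.sphere (0 : EuclideanSpace ℝ (Fin 2)) 1 → ↥(coresComplement h) :=
    fun θ => iA (G₀ (bX.incl (y' θ)))
  have ha' : ∀ θ, G₀ (bX.incl (y' θ)) = D.jA (a' θ) := fun θ => (Function.invFun_eq (hmem θ)).symm
  have ha'c : Continuous a' :=
    hiAc.comp_continuous (G₀.continuous.comp (bX.continuous_incl.comp hy'c)) hmem
  set L' : Metric.sphere (0 : EuclideanSpace ℝ (Fin 2)) 1 → Base g := fun θ => (a' θ : Base g)
  have hL'c : Continuous L' := continuous_subtype_val.comp ha'c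
  -- §f assembly
  exact ⟨ψ / 2, L, L', y, y', a, a', hεψ, hLc, hL'c, fun θ => rfl, hLp, hy, fun θ => rfl, hrel, ha',
    fun θ => rfl⟩

end Summit.SmoothPoincare4.SmoothPoincare4.Theorems.AcyclicBisectionExists.ModpBraidOrbits

end
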